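import Literature.NumberTheory.GaloisRepresentations.TeichmullerLiftMonomial
import HarnessLib

/-!
# Stub F `stub_seedOfExactOddLift`
# (line `birth`, crux `AdjointSeedFromDuality`, stmt-Langlands-16780)

Fact-free assembly of the seed from an EXACT lift.  Let `k = ℤ̄_p/𝔪 = padicAlgClResidueField p`
(`p ≥ 5`), `Γ = Γ_ℚ`.  Given `ρ : Γ → GL₃(ℚ̄_p)` with a reduction `ρ̄`, residual `τ̄ : Γ → GL₂(k)`
and `ψ̄ : Γ → kˣ` (open kernel) with `tr ρ̄ = ψ̄ · (tr τ̄² / det τ̄ − 1)`, a complex conjugation `c`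
with `det τ̄(c) = −1`, and a characteristic-zero `ρ₀ : Γ → GL₂(ℚ̄_p)` of which `τ̄` is a reduction:

* `ρ₀` is odd: for any complex conjugation `c'` (necessarily attached to the unique `ℚ →+* ℝ`, so
  conjugate to `c`, whence `det τ̄(c') = −1`), `det ρ₀(c')² = 1`; the value `det ρ₀(c') = 1` would
  give, through the integral model, `det τ̄(c') = 1`, i.e. `−1 = 1` in `k`, impossible for `p ≠ 2`.
* the Teichmüller lift `η` of `ψ̄` (`exists_teichmullerSection`; `ψ̄` has finite image, whose
  exponent has prime-to-`p` part `m`, and `kˣ` has no `p`-torsion) is a continuous character with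
  `η ≡ ψ̄ (mod 𝔪)`, and `tr ρ(σ) − η(σ)(tr ρ₀(σ)² / det ρ₀(σ) − 1)` is an element of `ℤ̄_p` with
  residue `tr ρ̄(σ) − ψ̄(σ)(tr τ̄(σ)² / det τ̄(σ) − 1) = 0`, i.e. of norm `< 1`.
-/

set_option linter.dupNamespace false -- `Summit.Langlands.Langlands` is the mandated namespace

namespace Summit.Langlands.Langlands.Cruxes.AdjointSeedFromDuality.Birth

open scoped MatrixGroups
open Literature.NumberTheory.GaloisRepresentations

/-! ### Generalities -/

/-- A group homomorphism out of a topological group with open kernel is continuous (private copy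
of `MonoidHom.continuous_of_isOpen_ker` of `GlobalArtinMapOfCharactersProofs`, not imported here).
[folklore] -/
private theorem seedF_continuous_of_isOpen_ker {G H : Type*} [Group G] [TopologicalSpace G]
    [IsTopologicalGroup G] [MulOneClass H] [TopologicalSpace H] [ContinuousMul H] (f : G →* H)
    (hf : IsOpen (f.ker : Set G)) : Continuous f := by
  apply continuous_of_continuousAt_one f
  rw [ContinuousAt, map_one]
  intro U hU
  rw [Filter.mem_map]
  apply Filter.mem_of_superset (hf.mem_nhds (by simp))
  intro g hg
  rw [SetLike.mem_coe, MonoidHom.mem_ker] at hg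
  rw [Set.mem_preimage, hg]
  exact mem_of_mem_nhds hU

/-- `ℤ̄_p/𝔪` has characteristic `p` (`‖p‖ = 1/p < 1`, so `p ∈ 𝔪`;
`Literature.RingTheory.Valuation.charP_residueField`). [folklore] -/
private theorem seedF_charP (p : ℕ) [Fact p.Prime] : CharP (padicAlgClResidueField p) p := by
  refine Literature.RingTheory.Valuation.charP_residueField (padicAlgClIntegers p) ?_
  rw [mem_maximalIdeal_iff_norm_lt_one (padicAlgCl_mem_valuationSubring_iff p)]
  have e : (((p : ℕ) : padicAlgClIntegers p) : PadicAlgCl p) = (p : PadicAlgCl p) := by simp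
  rw [e, ← PadicAlgCl.valuation_coe, PadicAlgCl.valuation_p]
  have hp : (1 : ℝ) < p := by exact_mod_cast (Fact.out : p.Prime).one_lt
  rw [NNReal.coe_div, NNReal.coe_one, NNReal.coe_natCast]
  exact (div_lt_one (by linarith)).2 hp

/-- In `ℤ̄_p/𝔪` with `p ≥ 5` (indeed `p ≠ 2`), `-1 ≠ 1`. [folklore] -/
private theorem seedF_neg_one_ne_one (p : ℕ) [Fact p.Prime] (hp : 5 ≤ p) :
    (-1 : padicAlgClResidueField p) ≠ 1 := by
  haveI := seedF_charP p
  intro h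
  have h2 : (2 : padicAlgClResidueField p) = 0 := by
    rw [← one_add_one_eq_two]
    nth_rw 2 [← h]
    rw [add_neg_cancel]
  have h' : ((2 : ℕ) : padicAlgClResidueField p) = 0 := by exact_mod_cast h2
  rw [CharP.cast_eq_zero_iff (padicAlgClResidueField p) p 2] at h'
  have := Nat.le_of_dvd (by norm_num) h'
  omega

/-! ### Integral models and reductions: traces and determinants -/

section Models

variable {p : ℕ} [Fact p.Prime] {G : Type*} [Group G] {n : ℕ}

/-- **Trace of an integral model.**  If `ρ₀(g) = P⁻¹ ρ(g) P` with `ρ₀` valued in `GL_n(ℤ̄_p)`, then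
`tr ρ₀(g)`, coerced to `ℚ̄_p`, is `tr ρ(g)`. [folklore] -/
private theorem seedF_coe_trace {ρ : G →* GL (Fin n) (PadicAlgCl p)}
    {ρ₀ : G →* GL (Fin n) (padicAlgClIntegers p)} {P : GL (Fin n) (PadicAlgCl p)}
    (hP : ∀ g, Matrix.GeneralLinearGroup.map (padicAlgClIntegers p).subtype (ρ₀ g) = P⁻¹ * ρ g * P)
    (g : G) :
    ((((ρ₀ g : GL (Fin n) (padicAlgClIntegers p)) :
        Matrix (Fin n) (Fin n) (padicAlgClIntegers p)).trace : padicAlgClIntegers p) :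
        PadicAlgCl p) =
      ((ρ g : GL (Fin n) (PadicAlgCl p)) : Matrix (Fin n) (Fin n) (PadicAlgCl p)).trace := by
  have h1 := congrArg
    (fun A : GL (Fin n) (PadicAlgCl p) => (A : Matrix (Fin n) (Fin n) (PadicAlgCl p)).trace) (hP g)
  simp only [Units.val_mul, Matrix.trace_units_conj'] at h1
  rw [← h1]
  exact AddMonoidHom.map_trace (padicAlgClIntegers p).subtype _

/-- **Determinant of an integral model.**  If `ρ₀(g) = P⁻¹ ρ(g) P` with `ρ₀` valued in
`GL_n(ℤ̄_p)`, then `det ρ₀(g) ∈ ℤ̄_pˣ`, coerced to `ℚ̄_p`, is `det ρ(g)`. [folklore] -/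
private theorem seedF_coe_det {ρ : G →* GL (Fin n) (PadicAlgCl p)}
    {ρ₀ : G →* GL (Fin n) (padicAlgClIntegers p)} {P : GL (Fin n) (PadicAlgCl p)}
    (hP : ∀ g, Matrix.GeneralLinearGroup.map (padicAlgClIntegers p).subtype (ρ₀ g) = P⁻¹ * ρ g * P)
    (g : G) :
    (((Matrix.GeneralLinearGroup.det (ρ₀ g) : (padicAlgClIntegers p)ˣ) : padicAlgClIntegers p) :
        PadicAlgCl p) =
      ((ρ g : GL (Fin n) (PadicAlgCl p)) : Matrix (Fin n) (Fin n) (PadicAlgCl p)).det := by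
  have h1 := congrArg
    (fun A : GL (Fin n) (PadicAlgCl p) => (A : Matrix (Fin n) (Fin n) (PadicAlgCl p)).det) (hP g)
  simp only [Units.val_mul, Matrix.det_units_conj'] at h1
  rw [← h1, Matrix.GeneralLinearGroup.val_det_apply]
  exact RingHom.map_det (padicAlgClIntegers p).subtype _

/-- **Inverse determinant of an integral model**: `(det ρ₀(g))⁻¹ ∈ ℤ̄_pˣ` coerces to `(det ρ(g))⁻¹`.
[folklore] -/
private theorem seedF_coe_det_inv {ρ : G →* GL (Fin n) (PadicAlgCl p)}
    {ρ₀ : G →* GL (Fin n) (padicAlgClIntegers p)} {P : GL (Fin n) (PadicAlgCl p)}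
    (hP : ∀ g, Matrix.GeneralLinearGroup.map (padicAlgClIntegers p).subtype (ρ₀ g) = P⁻¹ * ρ g * P)
    (g : G) :
    ((((Matrix.GeneralLinearGroup.det (ρ₀ g))⁻¹ : (padicAlgClIntegers p)ˣ) : padicAlgClIntegers p) :
        PadicAlgCl p) =
      (((ρ g : GL (Fin n) (PadicAlgCl p)) : Matrix (Fin n) (Fin n) (PadicAlgCl p)).det)⁻¹ := by
  rw [← seedF_coe_det hP g]
  apply eq_inv_of_mul_eq_one_left
  rw [← MulMemClass.coe_mul, ← Units.val_mul, inv_mul_cancel, Units.val_one, OneMemClass.coe_one]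

/-- **Trace of a reduction.**  If `τ(g) = Q (ρ₀(g) mod 𝔪) Q⁻¹`, then the residue of `tr ρ₀(g)` is
`tr τ(g)`. [folklore] -/
private theorem seedF_residue_trace {ρ₀ : G →* GL (Fin n) (padicAlgClIntegers p)}
    {τ : G →* GL (Fin n) (padicAlgClResidueField p)} {Q : GL (Fin n) (padicAlgClResidueField p)}
    (hQ : ∀ g, τ g = Q * integralReduction (RingHom.id (padicAlgClResidueField p)) ρ₀ g * Q⁻¹)
    (g : G) :
    IsLocalRing.residue (padicAlgClIntegers p)
        ((ρ₀ g : GL (Fin n) (padicAlgClIntegers p)) :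
          Matrix (Fin n) (Fin n) (padicAlgClIntegers p)).trace =
      ((τ g : GL (Fin n) (padicAlgClResidueField p)) :
        Matrix (Fin n) (Fin n) (padicAlgClResidueField p)).trace := by
  rw [hQ g, Units.val_mul, Units.val_mul, Matrix.trace_units_conj]
  exact AddMonoidHom.map_trace
    ((RingHom.id (padicAlgClResidueField p)).comp (IsLocalRing.residue (padicAlgClIntegers p))) _

/-- **Determinant of a reduction.**  If `τ(g) = Q (ρ₀(g) mod 𝔪) Q⁻¹`, then the residue of
`det ρ₀(g)` is `det τ(g)`. [folklore] -/
private theorem seedF_residue_det {ρ₀ : G →* GL (Fin n) (padicAlgClIntegers p)}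
    {τ : G →* GL (Fin n) (padicAlgClResidueField p)} {Q : GL (Fin n) (padicAlgClResidueField p)}
    (hQ : ∀ g, τ g = Q * integralReduction (RingHom.id (padicAlgClResidueField p)) ρ₀ g * Q⁻¹)
    (g : G) :
    IsLocalRing.residue (padicAlgClIntegers p)
        ((Matrix.GeneralLinearGroup.det (ρ₀ g) : (padicAlgClIntegers p)ˣ) : padicAlgClIntegers p) =
      ((τ g : GL (Fin n) (padicAlgClResidueField p)) :
        Matrix (Fin n) (Fin n) (padicAlgClResidueField p)).det := by
  rw [hQ g, Units.val_mul, Units.val_mul, Matrix.det_units_conj,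
    Matrix.GeneralLinearGroup.val_det_apply]
  exact RingHom.map_det
    ((RingHom.id (padicAlgClResidueField p)).comp (IsLocalRing.residue (padicAlgClIntegers p))) _

/-- **Inverse determinant of a reduction**: the residue of `(det ρ₀(g))⁻¹ ∈ ℤ̄_pˣ` is
`(det τ(g))⁻¹`. [folklore] -/
private theorem seedF_residue_det_inv {ρ₀ : G →* GL (Fin n) (padicAlgClIntegers p)}
    {τ : G →* GL (Fin n) (padicAlgClResidueField p)} {Q : GL (Fin n) (padicAlgClResidueField p)}
    (hQ : ∀ g, τ g = Q * integralReduction (RingHom.id (padicAlgClResidueField p)) ρ₀ g * Q⁻¹)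
    (g : G) :
    IsLocalRing.residue (padicAlgClIntegers p)
        (((Matrix.GeneralLinearGroup.det (ρ₀ g))⁻¹ : (padicAlgClIntegers p)ˣ) :
          padicAlgClIntegers p) =
      (((τ g : GL (Fin n) (padicAlgClResidueField p)) :
        Matrix (Fin n) (Fin n) (padicAlgClResidueField p)).det)⁻¹ := by
  rw [← seedF_residue_det hQ g]
  apply eq_inv_of_mul_eq_one_left
  rw [← map_mul, ← Units.val_mul, inv_mul_cancel, Units.val_one, map_one]

end Models

/-! ### Oddness of an exact lift -/

/-- **An exact lift of an odd residual representation is odd** (`p ≠ 2`).  If `τ̄` is a reduction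
of `ρ₀ : Γ_ℚ → GL₂(ℚ̄_p)` and `det τ̄(c) = -1` at a complex conjugation `c`, then `ρ₀` is odd: every
complex conjugation `c'` of `Γ_ℚ` is conjugate to `c` (`ℚ` has one real embedding,
`IsComplexConjugation.isConj`), so `det τ̄(c') = -1`; `det ρ₀(c') = ±1` (`c'² = 1`), and
`det ρ₀(c') = 1` forces `det` of the integral model at `c'` to be `1`, with residue
`det τ̄(c') = 1 ≠ -1`. [folklore] -/
private theorem seedF_isOdd (p : ℕ) [Fact p.Prime] (hp : 5 ≤ p)
    (τbar : Field.absoluteGaloisGroup ℚ →* GL (Fin 2) (padicAlgClResidueField p))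
    (φ : ℚ →+* ℝ) (c : Field.absoluteGaloisGroup ℚ) (hc : IsComplexConjugation φ c)
    (hodd : Matrix.GeneralLinearGroup.det (τbar c) = -1)
    (ρ₀ : FramedGaloisRep ℚ (PadicAlgCl p) 2)
    (hρ₀ : ρ₀.IsReductionOf (RingHom.id (padicAlgClResidueField p)) τbar) : ρ₀.IsOdd := by
  intro φ' c' hc'
  -- all complex conjugations of `Γ_ℚ` are conjugate: `det τ̄(c') = -1`
  have hφ : φ' = φ := Subsingleton.elim _ _
  subst hφ
  have hodd' : Matrix.GeneralLinearGroup.det (τbar c') = -1 := by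
    have h := isConj_iff_eq.mp
      ((Matrix.GeneralLinearGroup.det.comp τbar).map_isConj (hc.isConj hc'))
    rw [MonoidHom.comp_apply, MonoidHom.comp_apply] at h
    rw [← h, hodd]
  obtain ⟨ρ₁, Q, ⟨P, hP⟩, hQ⟩ := hρ₀
  -- `det ρ₀(c') = ±1`
  have hsq : ρ₀ c' * ρ₀ c' = 1 := by rw [← map_mul, ← sq, hc'.sq_eq_one, map_one]
  have hd : ((Matrix.GeneralLinearGroup.det (ρ₀ c') : (PadicAlgCl p)ˣ) : PadicAlgCl p) = 1 ∨
      ((Matrix.GeneralLinearGroup.det (ρ₀ c') : (PadicAlgCl p)ˣ) : PadicAlgCl p) = -1 := by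
    apply mul_self_eq_one_iff.mp
    rw [← Units.val_mul, ← map_mul, hsq, map_one, Units.val_one]
  rcases hd with h1 | h1
  swap
  · exact Units.ext (by rw [h1, Units.val_neg, Units.val_one])
  exfalso
  -- `det ρ₀(c') = 1`: the integral model has determinant `1` at `c'`, of residue `det τ̄(c') = 1`
  have h2 : ((Matrix.GeneralLinearGroup.det (ρ₁ c') : (padicAlgClIntegers p)ˣ) :
      padicAlgClIntegers p) = 1 := by
    apply Subtype.ext
    have h := seedF_coe_det hP c'
    rw [← Matrix.GeneralLinearGroup.val_det_apply] at h
    rw [h, OneMemClass.coe_one]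
    exact h1
  have h3 := seedF_residue_det hQ c'
  rw [h2, map_one, ← Matrix.GeneralLinearGroup.val_det_apply, hodd', Units.val_neg,
    Units.val_one] at h3
  exact seedF_neg_one_ne_one p hp h3.symm

/-! ### The Teichmüller lift of a residual character -/

/-- **Teichmüller lift of a residual character with open kernel.**  For `ψ̄ : Γ_ℚ → kˣ`
(`k = ℤ̄_p/𝔪`) with open kernel there is a continuous `η : Γ_ℚ → GL₁(ℚ̄_p)` whose entry
`η(σ)₀₀ = t(σ) ∈ ℤ̄_p` has residue `ψ̄(σ)`: `ψ̄` has finite image (open kernel in the compact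
`Γ_ℚ`), of exponent `N = p^e m` with `p ∤ m`; as `kˣ` has no `p`-torsion every value is an `m`-th
root of unity, and the Teichmüller section (`exists_teichmullerSection`) is multiplicative on
those, giving a homomorphism with kernel `⊇ ker ψ̄`, hence open, hence continuous. [folklore] -/
private theorem seedF_exists_teichmullerCharacter (p : ℕ) [Fact p.Prime]
    (ψbar : Field.absoluteGaloisGroup ℚ →* (padicAlgClResidueField p)ˣ)
    (hψopen : IsOpen ((ψbar.ker : Subgroup (Field.absoluteGaloisGroup ℚ)) :
      Set (Field.absoluteGaloisGroup ℚ))) :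
    ∃ (η : FramedGaloisRep ℚ (PadicAlgCl p) 1)
      (t : Field.absoluteGaloisGroup ℚ → padicAlgClIntegers p),
      (∀ σ, (η σ).val 0 0 = (t σ : PadicAlgCl p)) ∧
      ∀ σ, IsLocalRing.residue (padicAlgClIntegers p) (t σ) =
        ((ψbar σ : (padicAlgClResidueField p)ˣ) : padicAlgClResidueField p) := by
  -- `ψ̄` has finite image, of exponent `N = p ^ e * m` with `p ∤ m`
  haveI : Finite (Field.absoluteGaloisGroup ℚ ⧸ ψbar.ker) :=
    Subgroup.quotient_finite_of_isOpen _ hψopen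
  haveI : Finite ψbar.range :=
    Finite.of_equiv _ (QuotientGroup.quotientKerEquivRange ψbar).toEquiv
  haveI : Nonempty ψbar.range := ⟨1⟩
  have hN0 : Nat.card ψbar.range ≠ 0 := Nat.card_pos.ne'
  obtain ⟨e, m, hm, hN⟩ :=
    Nat.exists_eq_pow_mul_and_not_dvd hN0 p (Fact.out : p.Prime).one_lt.ne'
  have hm0 : 0 < m := by
    rcases Nat.eq_zero_or_pos m with h | h
    · rw [h, mul_zero] at hN
      exact absurd hN hN0
    · exact h
  have hpowN : ∀ σ, ψbar σ ^ Nat.card ψbar.range = 1 := fun σ => by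
    have h1 : (⟨ψbar σ, σ, rfl⟩ : ψbar.range) ^ Nat.card ψbar.range = 1 := pow_card_eq_one'
    have h2 := congrArg Subtype.val h1
    simpa using h2
  -- the values of `ψ̄` are `m`-th roots of unity (`kˣ` has no `p`-torsion)
  have hpow : ∀ σ, ((ψbar σ : (padicAlgClResidueField p)ˣ) : padicAlgClResidueField p) ^ m = 1 :=
    fun σ => by
      refine pow_eq_one_of_pow_prime_pow_mul_eq_one e ?_
      rw [← hN, ← Units.val_pow_eq_pow_val, hpowN σ, Units.val_one]
  obtain ⟨T, -, hT1, hT, hTmul⟩ := exists_teichmullerSection (p := p) hm0 hm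
  -- the bare character `σ ↦ T (ψ̄ σ)`
  have hne : ∀ σ, ((T ((ψbar σ : (padicAlgClResidueField p)ˣ) : padicAlgClResidueField p) :
      padicAlgClIntegers p) : PadicAlgCl p) ≠ 0 := by
    intro σ h0
    have h := (hT _ (hpow σ)).1
    rw [h0, zero_pow hm0.ne'] at h
    exact zero_ne_one h
  let χ : Field.absoluteGaloisGroup ℚ →* (PadicAlgCl p)ˣ :=
    { toFun := fun σ => Units.mk0 _ (hne σ)
      map_one' := by
        ext
        simp only [Units.val_mk0, map_one, Units.val_one, hT1, OneMemClass.coe_one]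
      map_mul' := fun σ σ' => by
        ext
        simp only [Units.val_mk0, map_mul, Units.val_mul]
        rw [hTmul _ _ (hpow σ) (hpow σ'), MulMemClass.coe_mul] }
  have hχ : ∀ σ, (χ σ : PadicAlgCl p) =
      ((T ((ψbar σ : (padicAlgClResidueField p)ˣ) : padicAlgClResidueField p) :
        padicAlgClIntegers p) : PadicAlgCl p) := fun σ => rfl
  -- its kernel contains the open `ker ψ̄`, so it is continuous
  have hker : ψbar.ker ≤ χ.ker := by
    intro σ hσ
    rw [MonoidHom.mem_ker] at hσ ⊢
    ext
    rw [hχ, hσ, Units.val_one, hT1, OneMemClass.coe_one, Units.val_one]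
  have hχopen : IsOpen ((χ.ker : Subgroup (Field.absoluteGaloisGroup ℚ)) :
      Set (Field.absoluteGaloisGroup ℚ)) :=
    Subgroup.isOpen_mono hker hψopen
  let χc : Field.absoluteGaloisGroup ℚ →ₜ* (PadicAlgCl p)ˣ :=
    ⟨χ, seedF_continuous_of_isOpen_ker χ hχopen⟩
  refine ⟨ContinuousMonoidHom.comp
      (FramedRep.unitsContinuousMulEquivOfUnique (Fin 1) (PadicAlgCl p) :
        (PadicAlgCl p)ˣ →ₜ* GL (Fin 1) (PadicAlgCl p)) χc,
    fun σ => T ((ψbar σ : (padicAlgClResidueField p)ˣ) : padicAlgClResidueField p),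
    fun σ => rfl, fun σ => (hT _ (hpow σ)).2⟩

/-! ### The stub -/

/-- **STUB F — the seed from an EXACT lift** (fact-free assembly).  For `p ≥ 5`,
`ρ : Γ_ℚ → GL₃(ℚ̄_p)` with reduction `ρ̄`, `tr ρ̄ = ψ̄·(tr τ̄²/det τ̄ − 1)` with `ker ψ̄` open,
`det τ̄(c) = −1` at a complex conjugation `c`, and a characteristic-zero `ρ₀ : Γ_ℚ → GL₂(ℚ̄_p)` of
which `τ̄` is a reduction: `ρ₀` is odd and `‖tr ρ(σ) − η(σ)(tr ρ₀(σ)²/det ρ₀(σ) − 1)‖ < 1` for the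
Teichmüller lift `η` of `ψ̄`.  Proof sketch: `det ρ₀(c′)` (`c′² = 1`) is `±1 ∈ ℤ̄_p` and reduces to
`det τ̄(c′) = det τ̄(c) = −1` (complex conjugations are conjugate, `IsComplexConjugation.isConj`),
and `1 ≢ −1 (mod 𝔪)` for `p ≠ 2`, so `det ρ₀(c′) = −1`; `ψ̄` has finite image of order prime to
`p` (no elements of order `p` in `kˣ`), so `exists_teichmullerSection` gives a continuous `η` with
residue `ψ̄`; `tr ρ(σ)`, `tr ρ₀(σ)`, `det ρ₀(σ)^{±1}`, `η(σ)` lie in `ℤ̄_p` (integral models) with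
residues `tr ρ̄(σ)`, `tr τ̄(σ)`, `det τ̄(σ)^{±1}`, `ψ̄(σ)`, so the displayed element of `ℤ̄_p` has
residue `0`, i.e. norm `< 1`. [folklore] -/
theorem stub_seedOfExactOddLift (p : ℕ) [Fact p.Prime] (hp : 5 ≤ p)
    (ρ : FramedGaloisRep ℚ (PadicAlgCl p) 3)
    (ρbar : Field.absoluteGaloisGroup ℚ →* GL (Fin 3) (padicAlgClResidueField p))
    (τbar : Field.absoluteGaloisGroup ℚ →* GL (Fin 2) (padicAlgClResidueField p))
    (ψbar : Field.absoluteGaloisGroup ℚ →* (padicAlgClResidueField p)ˣ)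
    (hred : ρ.IsReductionOf (RingHom.id (padicAlgClResidueField p)) ρbar)
    (hψopen : IsOpen ((ψbar.ker : Subgroup (Field.absoluteGaloisGroup ℚ)) :
      Set (Field.absoluteGaloisGroup ℚ)))
    (had : ∀ σ, (ρbar σ).val.trace =
      (ψbar σ).val * ((τbar σ).val.trace ^ 2 * ((τbar σ).val.det)⁻¹ - 1))
    (φ : ℚ →+* ℝ) (c : Field.absoluteGaloisGroup ℚ) (hc : IsComplexConjugation φ c)
    (hodd : Matrix.GeneralLinearGroup.det (τbar c) = -1)
    (ρ₀ : FramedGaloisRep ℚ (PadicAlgCl p) 2)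
    (hρ₀ : ρ₀.IsReductionOf (RingHom.id (padicAlgClResidueField p)) τbar) :
    ∃ η : FramedGaloisRep ℚ (PadicAlgCl p) 1,
      ρ₀.IsOdd ∧ ∀ σ, ‖(ρ σ).val.trace -
        (η σ).val 0 0 * ((ρ₀ σ).val.trace ^ 2 * ((ρ₀ σ).val.det)⁻¹ - 1)‖ < 1 := by
  obtain ⟨η, t, hη, ht⟩ := seedF_exists_teichmullerCharacter p ψbar hψopen
  refine ⟨η, seedF_isOdd p hp τbar φ c hc hodd ρ₀ hρ₀, fun σ => ?_⟩
  obtain ⟨ρint, Q', ⟨P', hP'⟩, hQ'⟩ := hred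
  obtain ⟨ρ₁, Q, ⟨P, hP⟩, hQ⟩ := hρ₀
  -- everything in sight is the image of an element of `ℤ̄_p`
  have htr : ((ρ σ : GL (Fin 3) (PadicAlgCl p)) : Matrix (Fin 3) (Fin 3) (PadicAlgCl p)).trace =
      ((((ρint σ : GL (Fin 3) (padicAlgClIntegers p)) :
        Matrix (Fin 3) (Fin 3) (padicAlgClIntegers p)).trace : padicAlgClIntegers p) :
        PadicAlgCl p) :=
    (seedF_coe_trace hP' σ).symm
  have htr₀ : ((ρ₀ σ : GL (Fin 2) (PadicAlgCl p)) : Matrix (Fin 2) (Fin 2) (PadicAlgCl p)).trace =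
      ((((ρ₁ σ : GL (Fin 2) (padicAlgClIntegers p)) :
        Matrix (Fin 2) (Fin 2) (padicAlgClIntegers p)).trace : padicAlgClIntegers p) :
        PadicAlgCl p) :=
    (seedF_coe_trace hP σ).symm
  have hdet₀ :
      (((ρ₀ σ : GL (Fin 2) (PadicAlgCl p)) : Matrix (Fin 2) (Fin 2) (PadicAlgCl p)).det)⁻¹ =
      ((((Matrix.GeneralLinearGroup.det (ρ₁ σ))⁻¹ : (padicAlgClIntegers p)ˣ) :
        padicAlgClIntegers p) : PadicAlgCl p) :=
    (seedF_coe_det_inv hP σ).symm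
  rw [htr, htr₀, hdet₀, hη σ]
  -- and that element has residue `tr ρ̄(σ) - ψ̄(σ) (tr τ̄(σ)² / det τ̄(σ) - 1) = 0`
  have key : ‖(((ρint σ).val.trace - t σ * ((ρ₁ σ).val.trace ^ 2 *
      ((Matrix.GeneralLinearGroup.det (ρ₁ σ))⁻¹ : (padicAlgClIntegers p)ˣ).val - 1) :
      padicAlgClIntegers p) : PadicAlgCl p)‖ < 1 := by
    rw [← mem_maximalIdeal_padicAlgClIntegers_iff_norm_lt_one, ← IsLocalRing.residue_eq_zero_iff,
      map_sub, map_mul, map_sub, map_mul, map_pow, map_one, ht σ, seedF_residue_trace hQ' σ,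
      seedF_residue_trace hQ σ, seedF_residue_det_inv hQ σ, had σ, sub_self]
  simpa only [AddSubgroupClass.coe_sub, MulMemClass.coe_mul, SubmonoidClass.coe_pow,
    OneMemClass.coe_one] using key

end Summit.Langlands.Langlands.Cruxes.AdjointSeedFromDuality.Birth
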